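import Mathlib
import HarnessLib
import HarnessLib.Audit
import Summits.PneNP.Statement
import Literature.Computability.MetaComplexity.LevinKt
import Literature.Computability.Complexity.CircuitClasses
import Literature.Computability.Complexity.Classes
import Literature.Computability.Complexity.Nondeterministic
import Literature.Computability.Complexity.BoolEncodings

/-!
Route: RootDecompKtPerebor

DORMANT since 2026-09-04T11:32:54Z (reconciler: no traction for 5 d (last activity statement-closed at 2026-08-30T10:56:28Z); parked, not closed — `ledger route dormant route-PneNP-RootDecompKtPerebor --off` to reactivate) — unstaffed, not closed; items shared with open routes are served there. `ledger route dormant <id> --off` reactivates.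

# Route RootDecompKtPerebor — Root decomposition on the Kt perebor dial at exponent 2/3

Root-decomposition cell decomp-pnenp, node N16 (lens-3 gen 5 «KtPereborDial» v3,
HOME/decomp-pnenp-lens-3/KtPereborDial.lean sha256 844e006f,
ktp/NODE-g5.md 44d4a215; critic decomp-pnenp-crit-1 CLEARED 2026-08-30T06:14:40Z). It suffices to
show X = A ∧ B on the Kt PEREBOR DIAL
Y(α) := «for every universal machine U, Levin's MKtP[s] is NOT in SIZE(c·2^{⌈α·s(N)⌉}·N^c + c) at
every threshold s» at the notch α = 2/3:
A = `KtPereborHard` (¬S → Y(2/3): in Algorithmica, deciding Kt ≤ s needs 2^{2s/3} non-uniform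
perebor; crux r2, ATTACKED) and B = `KtPereborLift`
(Y(2/3) → S; crux r3, DECLARED RESIDUAL, dominated by the corner conjunct `QuadTimeRung → PneNP` of
route WitnessCostSpaceLadder via the kernel
perebor law). Both pieces are formal consequences of S; S ↔ A ∧ B (`node_iff`, kernel). No card
realised (cell node).
Lean: `(¬ PneNP → ∀ U : Literature.Computability.MetaComplexity.UniversalMachine, ¬ (∀ s : ℕ → ℕ, ∃
c : ℕ, U.MKtP s ∈ Literature.Computability.Complexity.SIZE (fun N : ℕ => c * 2 ^ ⌈(2 / 3 : ℝ) * (s N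
: ℝ)⌉₊ * N ^ c + c))) ∧ ((∀ U : Literature.Computability.MetaComplexity.UniversalMachine, ¬ (∀ s : ℕ
→ ℕ, ∃ c : ℕ, U.MKtP s ∈ Literature.Computability.Complexity.SIZE (fun N : ℕ => c * 2 ^ ⌈(2 / 3 : ℝ)
* (s N : ℝ)⌉₊ * N ^ c + c))) → PneNP)`

## Assembly
Pure logic: `closes (hA : KtPereborHard) (hB : KtPereborLift) : PneNP := by by_contra h; exact h (hB
(hA h))` (glue.lean; cone = {KtPereborHard,
KtPereborLift}; every other item is an ASIDE — banked context, never staffed). Conjunct split S ↔ A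
∧ B: attacked = KtPereborHard, declared
residual = KtPereborLift (tribunal_fit).

Rationale: WHY THIS LINE. The mechanism is a one-parameter non-uniform SIZE dial on ONE fixed EXP-complete
compression problem (Levin's Kt, tree `UniversalMachine.MKtP`):
Y(α), α ∈ [0,1], antitone in α, with BOTH ENDS DECIDED in kernel with opposite polarity (α ≥ 1: Y
false by the table law `ktEasy_one`, so the
shadow is a COSTUME exactly there, `hard_iff_of_one_le`; α ≤ 0: the shadow is TRUE modulo the print
binder R_Kt EXP-complete under P/poly-tt
reductions, doi:10.1109/SFCS.2002.1181992 Cor 32, `ktPereborAt_zero_of_not_pneNP`) and an internal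
PEREBOR LAW (kernel `pereborLaw_holds`: a
fixed-exponent circuit bound n^K·polylog for the clocked-witness language W_U prices the dial at
K/(K+1), by the split MKtP-slice = short-program TABLE
∪ padded W_U-query, `mem_MKtP_iff_table_or_W`). Imported from meta-complexity: EXP-completeness of
R_Kt (Allender–Buhrman–Koucký–van Melkebeek–
Ronneburger 2002/2006) and worst-case function inversion / compression circuits
(Hirahara–Ilango–Williams STOC 2024, doi:10.1145/3618260.3649778,
Thm 1.2/1.4 and the 2^{e/2} open question p.26); from the textbook (AroraBarak2009 Thm 1.9, Rem 6.7,
Ex 6.7) the time-to-size and padding steps.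
The notch 2/3 is where the TIME road at its open corner (NTIME(n) ⊆ DTIME(n²) prices 2/3 via the law
at K = 2) and the INVERSION road at its
black-box optimum (inversion exponent θ = 1/2 ↦ crossover 2/3) MEET; print inversion sits at θ = 4/5
↦ 5/6 > 2/3, so Y(2/3) is undecided today.
What no prior route / negatives entry does: no cell route or PneNP Theses file dials the perebor
EXPONENT of a compression problem (N11 McspDial
dials reductions TO MCSP; WitnessCostSpaceLadder dials (time, space) of SAT; Ktlang's witness
language is ≡ S, census Z1); `ledger negatives
--problem PneNP` has 0 rows on Kt / MKtP / perebor.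

RANKED CRUXES. #2 KtPereborHard (crux) — SHADOW A (attacked): if P = NP then for every universal
machine U there is a threshold function s such that no constant c puts MKtP_U[s] in
SIZE(c·2^{⌈2s(N)/3⌉}·N^c + c) — in Algorithmica, Levin's Kt needs 2^{2s/3} non-uniform perebor (lens
decl `KtPereborHard := ¬PneNP → KtPereborAt (2/3)`, inlined). [difficulty: open-problem] (why it
might fail: False relative to TQBF (pencil: NTIME^TQBF(n) ⊆ DTIME^TQBF(n²) + relativized law gives
KtEasy(2/3) with S false); unrelativized it dies iff some U beats 2^{2s/3}, e.g. compression
circuits at 2^{e/2}·t·polylog (HIW open q.).) [doi:10.1145/3618260.3649778,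
doi:10.1109/SFCS.2002.1181992, AroraBarak2009, HOME/decomp-pnenp-lens-3/KtPereborDial.lean sha256
844e006f]
#3 KtPereborLift (crux) — LIFT B (DECLARED RESIDUAL): if for every universal machine U Levin's
MKtP_U[s] escapes SIZE(c·2^{⌈2s(N)/3⌉}·N^c + c) for some threshold s and every c, then P ≠ NP (lens
decl `KtPereborLift := KtPereborAt (2/3) → PneNP`, inlined). Dominated by WitnessCostSpaceLadder's
corner conjunct `QuadTimeRung → PneNP` via the kernel law `lift_of_timeLift'` modulo the three print
binders QuasilinearWitness, NPadQuad, TimeToSizeQuad (asides below). [deps: KtPereborHard]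
[difficulty: open-problem] (why it might fail: A direct proof must turn 2^{2s/3}-hardness of Kt into
P ≠ NP — no «Kt hard ⟹ P ≠ NP» transfer is in print (Kt-hardness results run toward EXP, HIW p.26);
the only typed road is the WCSL corner, itself summit-adjacent.) [doi:10.1145/3618260.3649778,
doi:10.1109/SFCS.2002.1181992, HOME/decomp-pnenp-lens-3/KtPereborDial.lean sha256 844e006f]
#9 KtPereborHardHalf (support) — sibling notch 1/2, shadow side (ASIDE, banked context): ¬S →
Y(1/2); immune to the inversion kill (crossover 1/2 needs θ = 0), priced only by a k = 1 + o(1)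
linear-time collapse. [difficulty: open-problem] [HOME/decomp-pnenp-lens-3/KtPereborDial.lean sha256
844e006f]
#9 KtPereborLiftHalf (support) — sibling notch 1/2, lift side (ASIDE, banked context): Y(1/2) → S
(`node_iff_half` in the lens file gives S ↔ HardHalf ∧ LiftHalf). [difficulty: open-problem]
[HOME/decomp-pnenp-lens-3/KtPereborDial.lean sha256 844e006f]
#9 RKtCompleteAll (support) — PRINT BINDER (ASIDE): for every universal machine U, if MKtP_U at
threshold (N-1)/2 is in P/poly then EXP ⊆ P/poly (R_Kt is EXP-complete under P/poly-truth-table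
reductions, ABKvMR Thm 31 / Cor 32; the threshold |x|/2 is arbitrary, p.12). Used by the lens
theorem `ktPereborAt_zero_of_not_pneNP` (decided end α ≤ 0). [difficulty: L]
[doi:10.1109/SFCS.2002.1181992]
#9 QuasilinearWitness (support) — CONSTRUCTION BINDER (ASIDE): some universal machine U has its
clocked-witness language W_U = {⟨x,⟨1^σ,1^τ⟩⟩ : ∃ p t, t ≤ τ ∧ U(p) prints x within t steps ∧ |p| +
⌈log t⌉ ≤ σ} in NTIME(n·(log n + 1)^k) for some k (Hennie–Stearns simulation; AroraBarak2009 Thm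
1.9). [difficulty: L] [AroraBarak2009]
#9 NPadQuad (support) — PADDING BINDER (ASIDE): NTIME(n) ⊆ DTIME(n²) implies NTIME(n·(log n+1)^k) ⊆
DTIME((n·(log n+1)^k)²) for every k (padding, AroraBarak2009 §2.6). [difficulty: M] [AroraBarak2009]
#9 TimeToSizeQuad (support) — TIME-TO-SIZE BINDER (ASIDE): DTIME((n·(log n+1)^k)²) ⊆ ⋃_c
SIZE(c·n²·(log n+1)^c + c) for every k (Pippenger–Fischer oblivious simulation; AroraBarak2009 Rem
6.7). [difficulty: M] [AroraBarak2009]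
#9 PereborLawTwo (support) — THE PEREBOR LAW at K = 2 (ASIDE, PROVABLE NOW: kernel theorem
`pereborLaw_holds 2` of the lens file, 0 sorry; a prover ports it to Theorems/): for every U, if W_U
∈ SIZE(c·n²·(log n+1)^c + c) for some c then MKtP_U[s] ∈ SIZE(c'·2^{⌈2s(N)/3⌉}·N^{c'} + c') for
every threshold s. [difficulty: provable-now] [HOME/decomp-pnenp-lens-3/KtPereborDial.lean sha256
844e006f, doi:10.1145/3618260.3649778]

TWO-LAYER PLAN. Foreseen split of KtPereborHard once a first rung closes: A ⇐ LinearStretch →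
StretchToNotch → A, where LinearStretch := ¬PneNP → ∀ U, ∃ δ > 0,
KtHard U δ (ABKvMR completeness with query-length bookkeeping + AroraBarak2009 Ex 6.7: P = NP ⟹ EXP
needs 2^n/n circuits) and StretchToNotch
:= the length-efficient E → MKtP hardness transfer from some δ > 0 to 2/3 (IDEA-NEEDED). Foreseen
split of KtPereborLift (if ever attacked directly):
B ⇐ PereborLawTwo → (QuadTimeRung → PneNP) → B via the three binders (kernel `lift_of_timeLift'`).
Nothing filed now.

KILL CRITERIA. `refuted:KtPereborHard` by ONE universal machine U with KtEasy U (2/3) (a circuit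
family of size c·2^{⌈2s/3⌉}·N^c + c deciding MKtP_U[s] at every s;
e.g. worst-case function inversion / compression circuits of size 2^{e/2}·t·polylog, HIW24 first
open question) closes the route outright
(`hard_false_of_easy`; the lift then becomes vacuous-true, `lift_trivial_of_easy`) — pivot = the
sibling notch 1/2 (asides KtPereborHardHalf /
KtPereborLiftHalf, immune to the inversion kill). A proof of WitnessCostSpaceLadder's CornerLift
corner conjunct (QuadTimeRung → PneNP) closes
KtPereborLift via the law (moots the residual). A proof that NTIME(n) ⊆ DTIME(n²) is consistent with
P = NP and Kt-hardness at 2/3 (oracle T_ORC)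
is informative, not a kill.

NOT DECOMPOSED YET. The first rung of the shadow (LinearStretch, δ > 0) and the stretch to the
notch; the direct road for the lift; the port of the lens kernel
(`pereborLaw_holds`, `ktEasy_one`, `hard_iff_of_one_le`, `ktPereborAt_zero_of_not_pneNP`,
`lift_of_timeLift'`, `node_iff`) to Theorems/ — all
layer-2 / prover work. The parameter-free cut Y_∀ (∀ α < 1) is NOT filed: it is a COSTUME by the
kernel theorem `hardForall_iff_pneNP` (lens v3).

CHEAPEST FALSIFIER. Desk-check T_HIW (15 min, lens ktp/NODE-g5.md §LAW): compose HIW24 Thm 1.2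
(inversion exponent 4/5) with U's clocked simulation and the table/level
split — gives KtEasy U (5c/(5c+1)) unconditionally; the notch 2/3 survives iff no inversion at
exponent θ ≤ 1/2 with linear time-overhead exists
(crossover β(θ,c) = c/(c+1-θ); θ = 1/2, c = 1 ↦ exactly 2/3). Literature watch T_FI: any
compression-circuit bound below 2^{e/2}·poly kills A.
Not runnable by kit here (kit_allowed = false); the lookup was run by the lens: print sits at θ =
4/5 (HIW p.3, p.23), 2^{e/2} listed OPEN (p.26).

NUMBERS. Inversion exponent in print θ = 4/5 (HIW24 Thm 1.4, circuits 2^{4n/5}·poly; Fiat–Naor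
2^{3n/4} with large advice); black-box barrier θ = 1/2
(De–Trevisan–Tulsiani 2010 / Yao 1990, HIW p.26); law price of a k-collapse NTIME(n) ⊆ DTIME(n^k):
k/(k+1) (k = 1 ↦ 1/2 excluded only up to
(log* n)^{1/4} by Paul–Pippenger–Szemerédi–Trotter 1983; k = 2 ↦ 2/3 OPEN = WCSL QuadTimeRung; k → ∞
↦ 1 = table law); ABKvMR threshold |x|/2.

DEFINITION REQUESTS. None: `UniversalMachine`, `MKtP`, `SIZE`, `PPoly`, `EXP`, `NTIME`, `DTIME`,
`boolUnpair` are tree declarations (oleans 08-25); the dial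
predicate is inlined. Port request (prover, when idle): the lens kernel theorems listed under «Not
decomposed yet» into
Summits/PneNP/PneNP/Theorems/RootDecompKtPerebor*.lean (PereborLawTwo closes by `pereborLaw_holds
2`).

Novelty: Searches (2026-08-30, lens-3 g5 + critic g3): lit search --hybrid "Levin Kt complexity circuit lower
bound exponential perebor" (hits: ABKvMR,
HIW24, AroraBarak2009 only); lit vsearch «R_Kt is EXP-complete, circuits for MKtP» --papers
(textbook + ABKvMR); lit galaxy search
"MKtP|Levin's Kt|Kt-complexity|Kt complexity" --star all (30 rows, all off-topic); lit galaxy search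
"perebor|brute-force search conjecture" --star all
(Trakhtenbrot-survey mentions only); lit read doi:10.1145/3618260.3649778 --pages 3,23,26 (Thm
1.2/1.4, open questions); lit read
doi:10.1109/SFCS.2002.1181992 --pages 2,12,17 (Thm 31 / Cor 32); ledger negatives --problem PneNP
(14 rows, 0 on Kt/MKtP/perebor); lean search
'MKtP|levinKt' --decl (tree LevinKt.lean, OliveiraSanthanam2018 thm3, OliveiraPichSanthanam2019
thm11_item1, Theses/Ktlang.lean).
Nearest prior art found: [corpus:paper:doi-10-1145-3618260-3649778 p.26] Hirahara–Ilango–Williams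
list «non-trivial worst-case circuits for MKtP»
and the 2^{e/2} compression barrier as OPEN; [corpus:paper:doi-10-1109-sfcs-2002-1181992 p.17]
ABKvMR Cor 32 (R_Kt EXP-complete); in tree
Theses/Ktlang.lean (witness language ≡ S, census Z1) and route-PneNP-RootDecompMcspDial (reductions
TO MCSP, N11); corpus+galaxy: no statement of
shape Y(α) → P ≠ NP or P = NP → Y(α) found.
Delta: the perebor EXPONENT of one fixed EXP-complete compression problem as a non-uniform SIZE dial
with both ends kernel-decided in opposite
polarity and an internal kernel law pricing the expone  [refs: 10.1145/3618260.3649778, 10.1109/SFCS.2002.1181992, doi:10.1145/3618260.3649778, doi:10.1109/SFCS.2002.1181992, paper:doi-10-1145-3618260-3649778, paper:doi-10-1109-sfcs-2002-1181992, AroraBarak2009, OliveiraSanthanam2018]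

Barriers (technique_class: meta-complexity, Kt-perebor-dial, padding): - technique_class: meta-complexity, Kt-perebor-dial, padding
- Literature.Barriers.PneNP.Relativization: KtPereborHard INSIDE one way — pencil: FALSE relative to
TQBF (NTIME^TQBF(n) ⊆ NSPACE(O(n)) ⊆ DTIME^TQBF(O(n²)) by one reachability-QBF query, then the
relativized law at K = 2 gives KtEasy^TQBF(2/3) while S^TQBF fails) and true relative to every P ≠
NP oracle ⟹ any proof of the shadow is NON-RELATIVIZING, exactly as for WitnessCostSpaceLadder's
corner; no evasion claimed, priced. KtPereborLift: declared residual, inherits the summit's oracle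
profile; STRICTLY WEAKER than S relativized (true rel. TQBF where S fails).
- Literature.Barriers.PneNP.NaturalProofs: KtPereborHard OUTSIDE-by-hypothesis — it asks for an
exponential non-uniform lower bound precisely in Algorithmica (¬S), where no pseudorandom function
families exist and the barrier theorem's hypothesis fails; any proof must USE ¬S (Y(2/3) outright
would give E ⊄ SIZE(2^{δn}), the IW97 hypothesis, HIW p.26). KtPereborLift: residual, exempt.
- Literature.Barriers.PneNP.Locality: INSIDE for the magnification road only (OliveiraSanthanam2018
thm3 / OliveiraPichSanthanam2019 thm11_item1 conclude EXP ⊄ P/poly, which ¬S already gives —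
magnification is idle in Algorithmica); the attacked road (length-efficient E → MKtP hardness
transfer) is not a magnification step.
- Literature.Barriers.PneNP.Algebrization: prices KtPereborLift exactly as it prices the summit; the
shadow's TQBF computation algebrizes as well (same verdict

History (route lifecycle, newest last):
- 2026-09-04T11:32:54Z · DORMANT — reconciler: no traction for 5 d (last activity statement-closed at 2026-08-30T10:56:28Z); parked, not closed — `ledger route dormant route-PneNP-RootDecompKtPer (operator:999:818426)

sub-problem: PneNP · status: dormant · opened planner-decomp-pnenp-writer-1-g4-0 2026-08-30T06:31:32Z · rev 0 · ledger route-PneNP-RootDecompKtPerebor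
GENERATED by the gate from the ledger (D-0016/17). Provers cite these decls: `theorem foo : Summit.PneNP.PneNP.Theses.RootDecompKtPerebor.<Decl> := …` in Summits/PneNP/PneNP/Theorems/<Name>.lean.
-/

namespace Summit.PneNP.PneNP.Theses.RootDecompKtPerebor

open scoped BigOperators Topology Manifold Classical MeasureTheory ProbabilityTheory Matrix InnerProductSpace ComplexConjugate ContinuousMap
open Filter Set Function TopologicalSpace MeasureTheory

attribute [summit_statement] _root_.PneNP

open Literature.PNP

/-- item stmt-PneNP-29367 · crux · rank 2 · open · by planner
why it might fail: False relative to TQBF (pencil: NTIME^TQBF(n) ⊆ DTIME^TQBF(n²) + relativized law gives KtEasy(2/3) with S false); unrelativized it dies iff some U beats 2^{2s/3}, e.g. compression circuits at 2^{e/2}·t·polylog (HIW open q.).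
sources: doi:10.1145/3618260.3649778, doi:10.1109/SFCS.2002.1181992, AroraBarak2009, HOME/decomp-pnenp-lens-3/KtPereborDial.lean sha256 844e006f
[crux] SHADOW A (attacked): if P = NP then for every universal machine U there is a threshold
function s such that no constant c puts MKtP_U[s] in SIZE(c·2^{⌈2s(N)/3⌉}·N^c + c) — in
Algorithmica, Levin's Kt needs 2^{2s/3} non-uniform perebor (lens decl `KtPereborHard := ¬PneNP →
KtPereborAt (2/3)`, inlined). [difficulty: open-problem] -/
@[route_item "route-PneNP-RootDecompKtPerebor"]
def KtPereborHard : Prop :=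
  ¬ PneNP → ∀ U : Literature.Computability.MetaComplexity.UniversalMachine, ¬ (∀ s : ℕ → ℕ, ∃ c : ℕ, U.MKtP s ∈ Literature.Computability.Complexity.SIZE (fun N : ℕ => c * 2 ^ ⌈(2 / 3 : ℝ) * (s N : ℝ)⌉₊ * N ^ c + c))

/-- item stmt-PneNP-29368 · crux · rank 3 · open · by planner
why it might fail: A direct proof must turn 2^{2s/3}-hardness of Kt into P ≠ NP — no «Kt hard ⟹ P ≠ NP» transfer is in print (Kt-hardness results run toward EXP, HIW p.26); the only typed road is the WCSL corner, itself summit-adjacent.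
sources: doi:10.1145/3618260.3649778, doi:10.1109/SFCS.2002.1181992, HOME/decomp-pnenp-lens-3/KtPereborDial.lean sha256 844e006f
[crux] LIFT B (DECLARED RESIDUAL): if for every universal machine U Levin's MKtP_U[s] escapes
SIZE(c·2^{⌈2s(N)/3⌉}·N^c + c) for some threshold s and every c, then P ≠ NP (lens decl
`KtPereborLift := KtPereborAt (2/3) → PneNP`, inlined). Dominated by WitnessCostSpaceLadder's corner
conjunct `QuadTimeRung → PneNP` via the kernel law `lift_of_timeLift'` modulo the three print
binders QuasilinearWitness, NPadQuad, TimeToSizeQuad (asides below). [deps: KtPereborHard]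
[difficulty: open-problem] -/
@[route_item "route-PneNP-RootDecompKtPerebor"]
def KtPereborLift : Prop :=
  (∀ U : Literature.Computability.MetaComplexity.UniversalMachine, ¬ (∀ s : ℕ → ℕ, ∃ c : ℕ, U.MKtP s ∈ Literature.Computability.Complexity.SIZE (fun N : ℕ => c * 2 ^ ⌈(2 / 3 : ℝ) * (s N : ℝ)⌉₊ * N ^ c + c))) → PneNP

/-- item stmt-PneNP-29369 · aside · rank 9 · open · by planner
sources: HOME/decomp-pnenp-lens-3/KtPereborDial.lean sha256 844e006f
[aside] sibling notch 1/2, shadow side (ASIDE, banked context): ¬S → Y(1/2); immune to the inversion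
kill (crossover 1/2 needs θ = 0), priced only by a k = 1 + o(1) linear-time collapse. [difficulty:
open-problem] -/
@[route_item "route-PneNP-RootDecompKtPerebor"]
def KtPereborHardHalf : Prop :=
  ¬ PneNP → ∀ U : Literature.Computability.MetaComplexity.UniversalMachine, ¬ (∀ s : ℕ → ℕ, ∃ c : ℕ, U.MKtP s ∈ Literature.Computability.Complexity.SIZE (fun N : ℕ => c * 2 ^ ⌈(1 / 2 : ℝ) * (s N : ℝ)⌉₊ * N ^ c + c))

/-- item stmt-PneNP-29370 · aside · rank 9 · open · by planner
sources: HOME/decomp-pnenp-lens-3/KtPereborDial.lean sha256 844e006f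
[aside] sibling notch 1/2, lift side (ASIDE, banked context): Y(1/2) → S (`node_iff_half` in the
lens file gives S ↔ HardHalf ∧ LiftHalf). [difficulty: open-problem] -/
@[route_item "route-PneNP-RootDecompKtPerebor"]
def KtPereborLiftHalf : Prop :=
  (∀ U : Literature.Computability.MetaComplexity.UniversalMachine, ¬ (∀ s : ℕ → ℕ, ∃ c : ℕ, U.MKtP s ∈ Literature.Computability.Complexity.SIZE (fun N : ℕ => c * 2 ^ ⌈(1 / 2 : ℝ) * (s N : ℝ)⌉₊ * N ^ c + c))) → PneNP

/-- item stmt-PneNP-29371 · aside · rank 9 · open · by planner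
sources: doi:10.1109/SFCS.2002.1181992
[aside] PRINT BINDER (ASIDE): for every universal machine U, if MKtP_U at threshold (N-1)/2 is in
P/poly then EXP ⊆ P/poly (R_Kt is EXP-complete under P/poly-truth-table reductions, ABKvMR Thm 31 /
Cor 32; the threshold |x|/2 is arbitrary, p.12). Used by the lens theorem
`ktPereborAt_zero_of_not_pneNP` (decided end α ≤ 0). [difficulty: L] -/
@[route_item "route-PneNP-RootDecompKtPerebor"]
def RKtCompleteAll : Prop :=
  ∀ U : Literature.Computability.MetaComplexity.UniversalMachine, U.MKtP (fun N : ℕ => (N - 1) / 2) ∈ Literature.Computability.Complexity.PPoly → Literature.Computability.Complexity.EXP ⊆ Literature.Computability.Complexity.PPoly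

/-- item stmt-PneNP-29372 · aside · rank 9 · open · by planner
sources: AroraBarak2009
[aside] CONSTRUCTION BINDER (ASIDE): some universal machine U has its clocked-witness language W_U =
{⟨x,⟨1^σ,1^τ⟩⟩ : ∃ p t, t ≤ τ ∧ U(p) prints x within t steps ∧ |p| + ⌈log t⌉ ≤ σ} in NTIME(n·(log n
+ 1)^k) for some k (Hennie–Stearns simulation; AroraBarak2009 Thm 1.9). [difficulty: L] -/
@[route_item "route-PneNP-RootDecompKtPerebor"]
def QuasilinearWitness : Prop :=
  ∃ (U : Literature.Computability.MetaComplexity.UniversalMachine) (k : ℕ), ({w : List Bool | ∃ (p : List Bool) (t : ℕ), t ≤ (Literature.Computability.Complexity.boolUnpair (Literature.Computability.Complexity.boolUnpair w).2).2.length ∧ U.run p t = some (Literature.Computability.Complexity.boolUnpair w).1 ∧ p.length + Nat.clog 2 t ≤ (Literature.Computability.Complexity.boolUnpair (Literature.Computability.Complexity.boolUnpair w).2).1.length} : Language Bool) ∈ Literature.Computability.Complexity.NTIME (fun n : ℕ => n * (Nat.log 2 n + 1) ^ k)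

/-- item stmt-PneNP-29373 · aside · rank 9 · open · by planner
sources: AroraBarak2009
[aside] PADDING BINDER (ASIDE): NTIME(n) ⊆ DTIME(n²) implies NTIME(n·(log n+1)^k) ⊆ DTIME((n·(log
n+1)^k)²) for every k (padding, AroraBarak2009 §2.6). [difficulty: M] -/
@[route_item "route-PneNP-RootDecompKtPerebor"]
def NPadQuad : Prop :=
  Literature.Computability.Complexity.NTIME (fun n : ℕ => n) ⊆ Literature.Computability.Complexity.DTIME (fun n : ℕ => n ^ 2) → ∀ k : ℕ, Literature.Computability.Complexity.NTIME (fun n : ℕ => n * (Nat.log 2 n + 1) ^ k) ⊆ Literature.Computability.Complexity.DTIME (fun n : ℕ => (n * (Nat.log 2 n + 1) ^ k) ^ 2)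

/-- item stmt-PneNP-29374 · aside · rank 9 · open · by planner
sources: AroraBarak2009
[aside] TIME-TO-SIZE BINDER (ASIDE): DTIME((n·(log n+1)^k)²) ⊆ ⋃_c SIZE(c·n²·(log n+1)^c + c) for
every k (Pippenger–Fischer oblivious simulation; AroraBarak2009 Rem 6.7). [difficulty: M] -/
@[route_item "route-PneNP-RootDecompKtPerebor"]
def TimeToSizeQuad : Prop :=
  ∀ k : ℕ, Literature.Computability.Complexity.DTIME (fun n : ℕ => (n * (Nat.log 2 n + 1) ^ k) ^ 2) ⊆ ⋃ c : ℕ, Literature.Computability.Complexity.SIZE (fun n : ℕ => c * n ^ 2 * (Nat.log 2 n + 1) ^ c + c)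

/-- item stmt-PneNP-29375 · aside · rank 9 · closed · proved by Summit.PneNP.PneNP.Theorems.pereborLawTwo_proof (prover) · by planner
sources: HOME/decomp-pnenp-lens-3/KtPereborDial.lean sha256 844e006f, doi:10.1145/3618260.3649778
[aside] THE PEREBOR LAW at K = 2 (ASIDE, PROVABLE NOW: kernel theorem `pereborLaw_holds 2` of the
lens file, 0 sorry; a prover ports it to Theorems/): for every U, if W_U ∈ SIZE(c·n²·(log n+1)^c +
c) for some c then MKtP_U[s] ∈ SIZE(c'·2^{⌈2s(N)/3⌉}·N^{c'} + c') for every threshold s.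
[difficulty: provable-now] -/
@[route_item "route-PneNP-RootDecompKtPerebor"]
def PereborLawTwo : Prop :=
  ∀ U : Literature.Computability.MetaComplexity.UniversalMachine, (∃ c : ℕ, ({w : List Bool | ∃ (p : List Bool) (t : ℕ), t ≤ (Literature.Computability.Complexity.boolUnpair (Literature.Computability.Complexity.boolUnpair w).2).2.length ∧ U.run p t = some (Literature.Computability.Complexity.boolUnpair w).1 ∧ p.length + Nat.clog 2 t ≤ (Literature.Computability.Complexity.boolUnpair (Literature.Computability.Complexity.boolUnpair w).2).1.length} : Language Bool) ∈ Literature.Computability.Complexity.SIZE (fun n : ℕ => c * n ^ 2 * (Nat.log 2 n + 1) ^ c + c)) → ∀ s : ℕ → ℕ, ∃ c : ℕ, U.MKtP s ∈ Literature.Computability.Complexity.SIZE (fun N : ℕ => c * 2 ^ ⌈(((2 : ℕ) : ℝ) / (((2 : ℕ) : ℝ) + 1)) * (s N : ℝ)⌉₊ * N ^ c + c)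

-- `PereborLawTwo` holds: proved by `Summit.PneNP.PneNP.Theorems.pereborLawTwo_proof` (its module imports this route file, so no `_holds` link can be stated here).

/-- item stmt-PneNP-29376 · assembly · rank 1 · open · by planner
sources: HOME/decomp-pnenp-lens-3/KtPereborDial.lean sha256 844e006f
[assembly] KtPereborHard → KtPereborLift → P ≠ NP. -/
@[route_item "route-PneNP-RootDecompKtPerebor"]
def Assembly : Prop :=
  KtPereborHard → KtPereborLift → PneNP

/-! D-0027 §2.1 — DECIDING THEOREM (planner-authored via `route open/edit --closes-file`; by planner-decomp-pnenp-writer-1-g4-0 2026-08-30T06:31:32Z):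
its hypotheses are this route's items and its conclusion the sub-problem Statement (glue_lint), and it elaborates with this file. -/

@[closes "route-PneNP-RootDecompKtPerebor"] theorem closes (hA : KtPereborHard) (hB : KtPereborLift) : _root_.PneNP := by
  by_contra h
  exact h (hB (hA h))

end Summit.PneNP.PneNP.Theses.RootDecompKtPerebor
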